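/-
Copyright (c) 2026 the pub-hodgecm-mathlib formalisation cell (harness21).  Prover seat hodgecm-mathlib-F0P3a-p06 (g26), 2026-09-03.  E1 BRICK LEDGER row 56-B3(59∕K2′-datum) «TAME
TWINS OF THE ROW-59 DATUM FILES», FILE (A) of 3 (E1 keeper ∕ dealer F0P3a-p03 (g30) 04:51:02Z «=» ×3; census `F0/P3a/F0P3a-p06/g26/b359/CENSUS-B3-59.v1.F0P3ap06g26.md`).
-/
import Summits.HodgeConjecture.HodgeConjecture.Theorems.F0P3cStCharTSTreeOrbitDataGqs               -- ★ (A) (F0P3-p01 g24): the UNR file (nothing of it is re-used by name; imported for the shared letters of ★ 48 FILE 1 ∕ ★ 41g-H)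
import Summits.HodgeConjecture.HodgeConjecture.Theorems.F0P3cStCharTSEPFunctionOrbitalOrbitsRamified  -- ★ 48-RAM FILE 1 (this seat) p853505: `exists_mapEdgeSet_eq_of_v_two` (one edge orbit at every `|2| = 1` involution place)
import Literature.NumberTheory.Automorphic.UnitaryLatticeTreeFramesOfInvolution                        -- ★ `isTree_latticeGraph_three_of_neg` (the tree at a tame ramified place)
import HarnessLib

/-!
# Row 56-B3(59), FILE (A) — THE TAME TWIN of ★ `F0P3cStCharTSTreeOrbitDataGqs`: the `U(Φ₃)(L⁺_v)`-orbit data of the lattice tree based at an edge `d₁` (one edge orbit, two vertex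
# orbits, ★ 57-B's letters at `ι₀ := Bool`, `ι₁ := Unit`) WITHOUT the unramified datum — Bruhat–Tits 1972 §10; Serre, *Trees* II.1.1

Cell `pub/hodgecm-mathlib` (D-0151), crux H413 = `stmt-HodgeConjecture-24833`; lane `--kind proof --supports stmt-HodgeConjecture-24833 --as helper` (THEOREMS ONLY: no definition ∕
instance ∕ notation ∕ named fact ∕ `sorry`; count-neutral: closes no node).  Namespace `Summit.HodgeConjecture.HodgeConjecture.Cruxes.H413.F0P3cStCharTSTreeOrbitDataGqsRamified`.
Sibling of ★ `…F0P3cStCharTSTreeOrbitDataGqs` (row 59, F0P3-p01 (g24)) — the hidden parent of ★ `…EPNormOneUnr` §1 — on ★ B3(53)'s pattern: its four heads re-issued with the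
unramified datum `hd` replaced POSITIONALLY (same slot: after `{ϖ}`, before `eA`; all binders are explicit in ★ already) by place letters: `exists_edgeOrbitData_gqs_of_v_two (hσ hvσ hϖ h2)`
(★ 48-RAM FILE 1 `exists_mapEdgeSet_eq_of_v_two`), `actionHom_head_ne_tail_of_v (hvσ hϖ)` (★ `type_of_lt_three`), `mem_headOrbit_or_mem_tailOrbit_of_neg` and `exists_vertexOrbitData_gqs_of_neg`
`(hσ hvσ hϖ hσϖ hres h2 hnorm)` (the seven TAME letters of ★ `isTree_latticeGraph_three_of_neg`, IN ORDER); every other binder and every conclusion VERBATIM; proofs = ★'s.  Consumer: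
FILE (C) `…EPNormOneRamified` (the tame K2′∕K4′ NORM-ONE modulo `hpc3`).
HONEST LABEL: count-neutral datum helper; TAME road GO-LOW (LEAD T15-42); WILD (dyadic) places stay PRINT (`h2 : |2| = 1` is a binder); E1 = PRINT until the rider rides; h413
OPEN; HC_CM is proved only modulo the 7 printed citations (2 remaining named inputs hLiu418 = stmt-HodgeConjecture-24832, h413 = stmt-HodgeConjecture-24833) until rung 0 closes;
nothing printed is asserted here.

## References
* [BruhatTits1972] F. Bruhat, J. Tits, *Groupes réductifs sur un corps local I*, Publ. Math. IHÉS 41 (1972): §10.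
* [Serre1980Trees] J.-P. Serre, *Trees* (1980): II.1.1.
* [SchneiderStuhler1997] P. Schneider, U. Stuhler, *Representation theory and sheaves on the Bruhat–Tits building*, Publ. Math. IHÉS 85 (1997): §III.4.
-/

set_option autoImplicit false

set_option linter.dupNamespace false

noncomputable section

open NumberField IsDedekindDomain
open scoped Valued WithZero Matrix MatrixGroups
open Literature.NumberTheory.Rogawski1990
open Literature.NumberTheory.Automorphic Literature.NumberTheory.Automorphic.UnitaryGroup Literature.NumberTheory.Automorphic.UnitaryLatticeTree
open Literature.NumberTheory.Automorphic.HermitianLattice Literature.NumberTheory.GaloisRepresentations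
open Literature.Combinatorics.SimpleGraph Literature.Combinatorics.SimpleGraph.OrientedIncidence

namespace Summit.HodgeConjecture.HodgeConjecture.Cruxes.H413.F0P3cStCharTSTreeOrbitDataGqsRamified

open Summit.HodgeConjecture.HodgeConjecture.Cruxes.H413
open Summit.HodgeConjecture.HodgeConjecture.Cruxes.H413.F0P3cStCharTSEPFunctionOrbitalOrbits
open Summit.HodgeConjecture.HodgeConjecture.Cruxes.H413.F0P3cStCharTSEPFunctionOrbitalOrbitsRamified

section Orbits

variable (L : Type) [Field L] [NumberField L] [IsCMField L] (v : HeightOneSpectrum (𝓞 ↥(maximalRealSubfield L)))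

/-! ## §1 ONE edge orbit: transporters to the base edge -/

/-- **EDGE ORBIT DATA on `G_v`**: every edge `e` of the tree is `g·d₁` for the chosen transporter `g = tr₁ e` (★ 48-datum FILE 1 `exists_mapEdgeSet_eq` — one edge orbit — and
choice).  With `ι₁ := Unit`, `xe := fun _ => d₁`, `idx₁ := fun _ => ()` these are ★ 57-B's edge letters (`hidx₁`, `hidx₁a` by `rfl`). [cite: BruhatTits1972, §10]
[cite: Serre1980Trees, II.1.1] -/
theorem exists_edgeOrbitData_gqs_of_v_two
    (w : PlacesOver L v) (hw : IsCMField.complexConj L • w.1 = w.1) {ϖ : (w.1.adicCompletion L)}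
    (hσ : ∀ x, (galAdicCompletionMap (L := L) (IsCMField.complexConj L) hw) ((galAdicCompletionMap (L := L) (IsCMField.complexConj L) hw) x) = x) (hvσ : ∀ x, Valued.v ((galAdicCompletionMap (L := L) (IsCMField.complexConj L) hw) x) = Valued.v x) (hϖ : Valued.v ϖ = WithZero.exp (-1 : ℤ)) (h2 : Valued.v (2 : (w.1.adicCompletion L)) = 1)
    (eA : (Gqs L v) ≃ₜ* ↥(unitaryGroupOfForm (galAdicCompletionMap (L := L) (IsCMField.complexConj L) hw) ((StdForm.antidiagonal 3).over (w.1.adicCompletion L))))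
    {a : (Gqs L v) →* ((latticeGraph (galAdicCompletionMap (L := L) (IsCMField.complexConj L) hw) ϖ ((StdForm.antidiagonal 3).over (w.1.adicCompletion L))) ≃g (latticeGraph (galAdicCompletionMap (L := L) (IsCMField.complexConj L) hw) ϖ ((StdForm.antidiagonal 3).over (w.1.adicCompletion L))))} (ha : ∀ g, a g = latticeGraphIso (galAdicCompletionMap (L := L) (IsCMField.complexConj L) hw) ϖ ((StdForm.antidiagonal 3).over (w.1.adicCompletion L)) (eA g))
    (τ : Orientation (latticeGraph (galAdicCompletionMap (L := L) (IsCMField.complexConj L) hw) ϖ ((StdForm.antidiagonal 3).over (w.1.adicCompletion L)))) (hτ : ∀ d, τ.tail d < τ.head d)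
    (d₁ : (latticeGraph (galAdicCompletionMap (L := L) (IsCMField.complexConj L) hw) ϖ ((StdForm.antidiagonal 3).over (w.1.adicCompletion L))).edgeSet) :
    ∃ tr₁ : (latticeGraph (galAdicCompletionMap (L := L) (IsCMField.complexConj L) hw) ϖ ((StdForm.antidiagonal 3).over (w.1.adicCompletion L))).edgeSet → Gqs L v, ∀ e, (a (tr₁ e)).mapEdgeSet d₁ = e :=
  ⟨fun e => (exists_mapEdgeSet_eq_of_v_two L v w hw hσ hvσ hϖ h2 eA ha τ hτ d₁ e).choose, fun e => (exists_mapEdgeSet_eq_of_v_two L v w hw hσ hvσ hϖ h2 eA ha τ hτ d₁ e).choose_spec⟩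

/-! ## §2 TWO vertex orbits: no element maps a head to a tail; every vertex is a translate of `τ.head d₁` or of `τ.tail d₁` -/

/-- **NO ELEMENT OF `G_v` MAPS `τ.head d₁` TO `τ.tail d₁`.**  If `a g (τ.head d₁) = τ.tail d₁`, then `τ.tail d₁` is the HEAD of the edge `g·d₁` (heads are equivariant, ★
`head_mapEdgeSet_latticeGraphIso`); ★ `type_of_lt_three` on `d₁` says the lattice `τ.tail d₁` has type `2`, and on `g·d₁` — fed with that type-`2` witness in the head slot — that it
has type `0`: `2 = 0`. [cite: BruhatTits1972, §10] -/
theorem actionHom_head_ne_tail_of_v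
    (w : PlacesOver L v) (hw : IsCMField.complexConj L • w.1 = w.1) {ϖ : (w.1.adicCompletion L)}
    (hvσ : ∀ x, Valued.v ((galAdicCompletionMap (L := L) (IsCMField.complexConj L) hw) x) = Valued.v x) (hϖ : Valued.v ϖ = WithZero.exp (-1 : ℤ))
    (eA : (Gqs L v) ≃ₜ* ↥(unitaryGroupOfForm (galAdicCompletionMap (L := L) (IsCMField.complexConj L) hw) ((StdForm.antidiagonal 3).over (w.1.adicCompletion L))))
    {a : (Gqs L v) →* ((latticeGraph (galAdicCompletionMap (L := L) (IsCMField.complexConj L) hw) ϖ ((StdForm.antidiagonal 3).over (w.1.adicCompletion L))) ≃g (latticeGraph (galAdicCompletionMap (L := L) (IsCMField.complexConj L) hw) ϖ ((StdForm.antidiagonal 3).over (w.1.adicCompletion L))))} (ha : ∀ g, a g = latticeGraphIso (galAdicCompletionMap (L := L) (IsCMField.complexConj L) hw) ϖ ((StdForm.antidiagonal 3).over (w.1.adicCompletion L)) (eA g))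
    (τ : Orientation (latticeGraph (galAdicCompletionMap (L := L) (IsCMField.complexConj L) hw) ϖ ((StdForm.antidiagonal 3).over (w.1.adicCompletion L)))) (hτ : ∀ d, τ.tail d < τ.head d)
    (d₁ : (latticeGraph (galAdicCompletionMap (L := L) (IsCMField.complexConj L) hw) ϖ ((StdForm.antidiagonal 3).over (w.1.adicCompletion L))).edgeSet) (g : Gqs L v) : a g (τ.head d₁) ≠ τ.tail d₁ := by
  intro hg
  have hJ : Valued.v (((StdForm.antidiagonal 3).over (w.1.adicCompletion L))).det = 1 := v_det_antidiagonal_three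
  have hσa := head_mapEdgeSet_latticeGraphIso (galAdicCompletionMap (L := L) (IsCMField.complexConj L) hw) ϖ ((StdForm.antidiagonal 3).over (w.1.adicCompletion L)) hτ (eA g) d₁
  rw [← ha] at hσa
  -- the type of `τ.tail d₁` is `2` (edge `d₁`) …
  obtain ⟨k₀, hk₀⟩ := (τ.head d₁).2
  obtain ⟨k₂, hk₂⟩ := (τ.tail d₁).2
  obtain ⟨hk₂2, -⟩ := type_of_lt_three hvσ hϖ hJ hk₂ hk₀ (Subtype.coe_lt_coe.2 (hτ d₁))
  -- … and `0` (it is the head of `g·d₁`)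
  obtain ⟨m, hm⟩ := (τ.tail ((a g).mapEdgeSet d₁)).2
  have hk₂' : IsVertexLattice (galAdicCompletionMap (L := L) (IsCMField.complexConj L) hw) ϖ ((StdForm.antidiagonal 3).over (w.1.adicCompletion L)) k₂ (τ.head ((a g).mapEdgeSet d₁)).1 := by
    rw [hσa.1, hg]; exact hk₂
  obtain ⟨-, hk₂0⟩ := type_of_lt_three hvσ hϖ hJ hm hk₂' (Subtype.coe_lt_coe.2 (hτ ((a g).mapEdgeSet d₁)))
  omega

set_option maxHeartbeats 1600000 in
/-- **EVERY VERTEX IS A TRANSLATE OF `τ.head d₁` OR OF `τ.tail d₁`.**  A vertex `x` lies on some edge `e` (the tree is connected and has the two distinct vertices `τ.head d₁ ≠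
τ.tail d₁`: first dart of a walk from `x`); `e = g·d₁` (§1), and `x ∈ {τ.head e, τ.tail e} = {a g (τ.head d₁), a g (τ.tail d₁)}`. [cite: BruhatTits1972, §10] [cite: Serre1980Trees, II.1.1] -/
theorem mem_headOrbit_or_mem_tailOrbit_of_neg
    (w : PlacesOver L v) (hw : IsCMField.complexConj L • w.1 = w.1) {ϖ : (w.1.adicCompletion L)}
    (hσ : ∀ x, (galAdicCompletionMap (L := L) (IsCMField.complexConj L) hw) ((galAdicCompletionMap (L := L) (IsCMField.complexConj L) hw) x) = x) (hvσ : ∀ x, Valued.v ((galAdicCompletionMap (L := L) (IsCMField.complexConj L) hw) x) = Valued.v x) (hϖ : Valued.v ϖ = WithZero.exp (-1 : ℤ))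
    (hσϖ : (galAdicCompletionMap (L := L) (IsCMField.complexConj L) hw) ϖ = -ϖ) (hres : ∀ x : (w.1.adicCompletion L), Valued.v x ≤ 1 → Valued.v ((galAdicCompletionMap (L := L) (IsCMField.complexConj L) hw) x - x) < 1) (h2 : Valued.v (2 : (w.1.adicCompletion L)) = 1) (hnorm : ∀ u : (w.1.adicCompletion L), (galAdicCompletionMap (L := L) (IsCMField.complexConj L) hw) u = u → Valued.v (u - 1) < 1 → ∃ z : (w.1.adicCompletion L), z * (galAdicCompletionMap (L := L) (IsCMField.complexConj L) hw) z = u ∧ Valued.v (z - 1) ≤ Valued.v (u - 1))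
    (eA : (Gqs L v) ≃ₜ* ↥(unitaryGroupOfForm (galAdicCompletionMap (L := L) (IsCMField.complexConj L) hw) ((StdForm.antidiagonal 3).over (w.1.adicCompletion L))))
    {a : (Gqs L v) →* ((latticeGraph (galAdicCompletionMap (L := L) (IsCMField.complexConj L) hw) ϖ ((StdForm.antidiagonal 3).over (w.1.adicCompletion L))) ≃g (latticeGraph (galAdicCompletionMap (L := L) (IsCMField.complexConj L) hw) ϖ ((StdForm.antidiagonal 3).over (w.1.adicCompletion L))))} (ha : ∀ g, a g = latticeGraphIso (galAdicCompletionMap (L := L) (IsCMField.complexConj L) hw) ϖ ((StdForm.antidiagonal 3).over (w.1.adicCompletion L)) (eA g))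
    (τ : Orientation (latticeGraph (galAdicCompletionMap (L := L) (IsCMField.complexConj L) hw) ϖ ((StdForm.antidiagonal 3).over (w.1.adicCompletion L)))) (hτ : ∀ d, τ.tail d < τ.head d)
    (d₁ : (latticeGraph (galAdicCompletionMap (L := L) (IsCMField.complexConj L) hw) ϖ ((StdForm.antidiagonal 3).over (w.1.adicCompletion L))).edgeSet) (x : {M : Submodule 𝒪[(w.1.adicCompletion L)] (Fin 3 → (w.1.adicCompletion L)) // IsVertex (galAdicCompletionMap (L := L) (IsCMField.complexConj L) hw) ϖ ((StdForm.antidiagonal 3).over (w.1.adicCompletion L)) M}) :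
    (∃ g : Gqs L v, a g (τ.head d₁) = x) ∨ ∃ g : Gqs L v, a g (τ.tail d₁) = x := by
  classical
  have hT := isTree_latticeGraph_three_of_neg hσ hvσ hϖ hσϖ hres h2 hnorm
  have hσa : ∀ (g : Gqs L v) (d : (latticeGraph (galAdicCompletionMap (L := L) (IsCMField.complexConj L) hw) ϖ ((StdForm.antidiagonal 3).over (w.1.adicCompletion L))).edgeSet), τ.head ((a g).mapEdgeSet d) = a g (τ.head d) ∧ τ.tail ((a g).mapEdgeSet d) = a g (τ.tail d) := fun g d => by
    rw [ha]; exact head_mapEdgeSet_latticeGraphIso (galAdicCompletionMap (L := L) (IsCMField.complexConj L) hw) ϖ ((StdForm.antidiagonal 3).over (w.1.adicCompletion L)) hτ (eA g) d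
  -- an edge `e` through `x`: first dart of a walk from `x` to a vertex `y₀ ≠ x`
  have hne : τ.head d₁ ≠ τ.tail d₁ := fun h => actionHom_head_ne_tail_of_v L v w hw hvσ hϖ eA ha τ hτ d₁ 1 (by rw [map_one, RelIso.one_apply]; exact h)
  obtain ⟨y₀, hy₀⟩ : ∃ y₀ : {M : Submodule 𝒪[(w.1.adicCompletion L)] (Fin 3 → (w.1.adicCompletion L)) // IsVertex (galAdicCompletionMap (L := L) (IsCMField.complexConj L) hw) ϖ ((StdForm.antidiagonal 3).over (w.1.adicCompletion L)) M}, y₀ ≠ x := by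
    by_cases hx : τ.head d₁ = x
    · exact ⟨τ.tail d₁, fun h => hne (hx.trans h.symm)⟩
    · exact ⟨τ.head d₁, hx⟩
  obtain ⟨p⟩ := hT.connected x y₀
  obtain ⟨y, hxy⟩ : ∃ y, (latticeGraph (galAdicCompletionMap (L := L) (IsCMField.complexConj L) hw) ϖ ((StdForm.antidiagonal 3).over (w.1.adicCompletion L))).Adj x y := by
    cases p with
    | nil => exact absurd rfl hy₀
    | cons hadj _ => exact ⟨_, hadj⟩
  let e : (latticeGraph (galAdicCompletionMap (L := L) (IsCMField.complexConj L) hw) ϖ ((StdForm.antidiagonal 3).over (w.1.adicCompletion L))).edgeSet := ⟨s(x, y), (SimpleGraph.mem_edgeSet _).2 hxy⟩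
  -- `e = g·d₁`, so `{head e, tail e} = {a g (head d₁), a g (tail d₁)} = {x, y}`
  obtain ⟨tr₁, htr₁⟩ := exists_edgeOrbitData_gqs_of_v_two L v w hw hσ hvσ hϖ h2 eA ha τ hτ d₁
  have hends : s(τ.head e, τ.tail e) = s(x, y) := τ.mk_head_tail e
  rw [← htr₁ e, (hσa (tr₁ e) d₁).1, (hσa (tr₁ e) d₁).2] at hends
  rcases Sym2.eq_iff.1 hends with ⟨h1, -⟩ | ⟨-, h2⟩
  · exact Or.inl ⟨tr₁ e, h1⟩
  · exact Or.inr ⟨tr₁ e, h2⟩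

/-! ## §3 Vertex orbit data in ★ 57-B's letters (`ι₀ := Bool`) -/

set_option maxHeartbeats 1600000 in
/-- **VERTEX ORBIT DATA on `G_v` BASED AT THE ENDPOINTS OF `d₁`**: an orbit index `idx₀ : X₀ → Bool` (`true` = the orbit of `τ.head d₁` = the self-dual vertices, `false` = the
orbit of `τ.tail d₁` = the type-two vertices) and transporters `tr₀` with `idx₀ (xv b) = b`, `idx₀ (g·x) = idx₀ x`, `tr₀ x · xv (idx₀ x) = x` for `xv := fun b => cond b (τ.head d₁)
(τ.tail d₁)` — ★ 57-B's letters `hidx₀ hidx₀a htr₀` at `ι₀ := Bool` (§2 + choice). [cite: BruhatTits1972, §10] [cite: Serre1980Trees, II.1.1] [cite: SchneiderStuhler1997, §III.4] -/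
theorem exists_vertexOrbitData_gqs_of_neg
    (w : PlacesOver L v) (hw : IsCMField.complexConj L • w.1 = w.1) {ϖ : (w.1.adicCompletion L)}
    (hσ : ∀ x, (galAdicCompletionMap (L := L) (IsCMField.complexConj L) hw) ((galAdicCompletionMap (L := L) (IsCMField.complexConj L) hw) x) = x) (hvσ : ∀ x, Valued.v ((galAdicCompletionMap (L := L) (IsCMField.complexConj L) hw) x) = Valued.v x) (hϖ : Valued.v ϖ = WithZero.exp (-1 : ℤ))
    (hσϖ : (galAdicCompletionMap (L := L) (IsCMField.complexConj L) hw) ϖ = -ϖ) (hres : ∀ x : (w.1.adicCompletion L), Valued.v x ≤ 1 → Valued.v ((galAdicCompletionMap (L := L) (IsCMField.complexConj L) hw) x - x) < 1) (h2 : Valued.v (2 : (w.1.adicCompletion L)) = 1) (hnorm : ∀ u : (w.1.adicCompletion L), (galAdicCompletionMap (L := L) (IsCMField.complexConj L) hw) u = u → Valued.v (u - 1) < 1 → ∃ z : (w.1.adicCompletion L), z * (galAdicCompletionMap (L := L) (IsCMField.complexConj L) hw) z = u ∧ Valued.v (z - 1) ≤ Valued.v (u - 1))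
    (eA : (Gqs L v) ≃ₜ* ↥(unitaryGroupOfForm (galAdicCompletionMap (L := L) (IsCMField.complexConj L) hw) ((StdForm.antidiagonal 3).over (w.1.adicCompletion L))))
    {a : (Gqs L v) →* ((latticeGraph (galAdicCompletionMap (L := L) (IsCMField.complexConj L) hw) ϖ ((StdForm.antidiagonal 3).over (w.1.adicCompletion L))) ≃g (latticeGraph (galAdicCompletionMap (L := L) (IsCMField.complexConj L) hw) ϖ ((StdForm.antidiagonal 3).over (w.1.adicCompletion L))))} (ha : ∀ g, a g = latticeGraphIso (galAdicCompletionMap (L := L) (IsCMField.complexConj L) hw) ϖ ((StdForm.antidiagonal 3).over (w.1.adicCompletion L)) (eA g))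
    (τ : Orientation (latticeGraph (galAdicCompletionMap (L := L) (IsCMField.complexConj L) hw) ϖ ((StdForm.antidiagonal 3).over (w.1.adicCompletion L)))) (hτ : ∀ d, τ.tail d < τ.head d)
    (d₁ : (latticeGraph (galAdicCompletionMap (L := L) (IsCMField.complexConj L) hw) ϖ ((StdForm.antidiagonal 3).over (w.1.adicCompletion L))).edgeSet) :
    ∃ (idx₀ : {M : Submodule 𝒪[(w.1.adicCompletion L)] (Fin 3 → (w.1.adicCompletion L)) // IsVertex (galAdicCompletionMap (L := L) (IsCMField.complexConj L) hw) ϖ ((StdForm.antidiagonal 3).over (w.1.adicCompletion L)) M} → Bool) (tr₀ : {M : Submodule 𝒪[(w.1.adicCompletion L)] (Fin 3 → (w.1.adicCompletion L)) // IsVertex (galAdicCompletionMap (L := L) (IsCMField.complexConj L) hw) ϖ ((StdForm.antidiagonal 3).over (w.1.adicCompletion L)) M} → Gqs L v),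
      (∀ b : Bool, idx₀ (cond b (τ.head d₁) (τ.tail d₁)) = b) ∧
      (∀ (g : Gqs L v) (x : {M : Submodule 𝒪[(w.1.adicCompletion L)] (Fin 3 → (w.1.adicCompletion L)) // IsVertex (galAdicCompletionMap (L := L) (IsCMField.complexConj L) hw) ϖ ((StdForm.antidiagonal 3).over (w.1.adicCompletion L)) M}), idx₀ (a g x) = idx₀ x) ∧
      ∀ x : {M : Submodule 𝒪[(w.1.adicCompletion L)] (Fin 3 → (w.1.adicCompletion L)) // IsVertex (galAdicCompletionMap (L := L) (IsCMField.complexConj L) hw) ϖ ((StdForm.antidiagonal 3).over (w.1.adicCompletion L)) M}, a (tr₀ x) (cond (idx₀ x) (τ.head d₁) (τ.tail d₁)) = x := by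
  classical
  have hne := actionHom_head_ne_tail_of_v L v w hw hvσ hϖ eA ha τ hτ d₁
  have hcover := mem_headOrbit_or_mem_tailOrbit_of_neg L v w hw hσ hvσ hϖ hσϖ hres h2 hnorm eA ha τ hτ d₁
  -- the orbit of the head is disjoint from the orbit of the tail
  have hdisj : ∀ x : {M : Submodule 𝒪[(w.1.adicCompletion L)] (Fin 3 → (w.1.adicCompletion L)) // IsVertex (galAdicCompletionMap (L := L) (IsCMField.complexConj L) hw) ϖ ((StdForm.antidiagonal 3).over (w.1.adicCompletion L)) M}, (∃ g : Gqs L v, a g (τ.head d₁) = x) → ¬ ∃ g : Gqs L v, a g (τ.tail d₁) = x := by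
    rintro x ⟨g, hg⟩ ⟨g', hg'⟩
    refine hne (g'⁻¹ * g) ?_
    rw [map_mul, map_inv, RelIso.mul_apply, hg, ← hg', RelIso.inv_apply_self]
  have htail : ∀ x : {M : Submodule 𝒪[(w.1.adicCompletion L)] (Fin 3 → (w.1.adicCompletion L)) // IsVertex (galAdicCompletionMap (L := L) (IsCMField.complexConj L) hw) ϖ ((StdForm.antidiagonal 3).over (w.1.adicCompletion L)) M}, ¬ (∃ g : Gqs L v, a g (τ.head d₁) = x) → ∃ g : Gqs L v, a g (τ.tail d₁) = x := fun x hx => (hcover x).resolve_left hx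
  refine ⟨fun x => decide (∃ g : Gqs L v, a g (τ.head d₁) = x),
    fun x => if hx : ∃ g : Gqs L v, a g (τ.head d₁) = x then hx.choose else (htail x hx).choose, ?_, ?_, ?_⟩
  · -- `idx₀ (xv b) = b`
    intro b
    dsimp only
    cases b with
    | true =>
      rw [cond_true, decide_eq_true_eq]
      exact ⟨1, by rw [map_one, RelIso.one_apply]⟩
    | false =>
      rw [cond_false, decide_eq_false_iff_not]
      rintro ⟨g, hg⟩
      exact hne g hg
  · -- `idx₀ (g·x) = idx₀ x`: the head orbit is `a`-stable
    intro g x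
    dsimp only
    refine Bool.decide_congr ⟨?_, ?_⟩
    · rintro ⟨g', hg'⟩
      exact ⟨g⁻¹ * g', by rw [map_mul, map_inv, RelIso.mul_apply, hg', RelIso.inv_apply_self]⟩
    · rintro ⟨g', hg'⟩
      exact ⟨g * g', by rw [map_mul, RelIso.mul_apply, hg']⟩
  · -- `tr₀ x · xv (idx₀ x) = x`
    intro x
    dsimp only
    by_cases hx : ∃ g : Gqs L v, a g (τ.head d₁) = x
    · rw [dif_pos hx, decide_eq_true hx, cond_true]
      exact hx.choose_spec
    · rw [dif_neg hx, (decide_eq_false_iff_not).2 hx, cond_false]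
      exact (htail x hx).choose_spec

end Orbits

end Summit.HodgeConjecture.HodgeConjecture.Cruxes.H413.F0P3cStCharTSTreeOrbitDataGqsRamified

end
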